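import Literature.Geometry.Kaehler.AnalyticSetZeroDimensional
import Literature.Geometry.Kaehler.AnalyticSetFiniteIntersection
import HarnessLib

/-!
# Analytic sets of excess dimension do not meet in isolated points

Layer `Literature/Geometry/Kaehler`; lane `lit-hodgefound`, seat p07, programme «DIMENSION OF
INTERSECTIONS», file 6. [Chirka1989, §3.5 Prop. 2 and §12.1]: the codimension of `A₁ ∩ ⋯ ∩ A_k`
at each of its points does not exceed `Σ codim A_j`; hence, when `Σ codim A_j < n` (the
dimensions are in excess, `Σ dim A_j > (k - 1) n`), no point of `⋂ A_j` is isolated — an isolated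
point would be a regular point of codimension `n` (`AnalyticSetZeroDimensional.lean`). In the
language of [Chirka1989, §12.1]: the intersection can be *zero-dimensional* only in the case of
complementary (or deficient) dimensions `Σ codim A_j ≥ n`. For analytic subsets of a complex
manifold `M` modelled on the `n`-dimensional space `E`:

* `HasPureCodim.finrank_le_add_of_isolated_inter`, `HasPureCodim.not_isolated_of_mem_inter` —
  two sets: an isolated point of `Z₁ ∩ Z₂` forces `n ≤ c₁ + c₂`; **if `c₁ + c₂ < n` then
  `Z₁ ∩ Z₂` has no isolated point** (`dim_a (Z₁ ∩ Z₂) ≥ p₁ + p₂ - n > 0`);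
  `HasPureDim.not_isolated_of_mem_inter` — dimension form `p₁ + p₂ > n`;
* `HasPureCodim.finrank_le_sum_of_isolated_biInter`,
  `HasPureCodim.not_isolated_of_mem_biInter` — the same for finite families `⋂_{i ∈ s} Z_i` with
  `Σ_{i ∈ s} c_i < n`;
* `HasPureCodim.not_hasPureDim_zero_inter`, `HasPureCodim.not_hasPureDim_zero_biInter` — in
  excess dimensions the intersection is never zero-dimensional.

Theorems only; no new definitions, no named facts.

## References

* [Chirka1989] E. M. Chirka, *Complex Analytic Sets*, Kluwer 1989, §2.3 (p. 23), §3.5 Prop. 2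
  (p. 36), §12.1 (p. 136) (held `book:chirkand-complex-analytic-sets`, PDF p0047, p0151).
-/

noncomputable section

open scoped Manifold Topology
open Set Filter Function

namespace Literature.Geometry.Kaehler

variable {E : Type*} [NormedAddCommGroup E] [NormedSpace ℂ E] [FiniteDimensional ℂ E]
  {M : Type*} [TopologicalSpace M] [ChartedSpace E M] [IsManifold 𝓘(ℂ, E) 1 M]

/-! ### Two sets -/

/-- **An isolated point of `Z₁ ∩ Z₂` forces `n ≤ codim Z₁ + codim Z₂`**: it is a regular point of
`Z₁ ∩ Z₂` of codimension `n`, and every regular point of `Z₁ ∩ Z₂` has codimension `≤ c₁ + c₂`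
[Chirka1989, §3.5 Prop. 2]. [cite: Chirka1989, §3.5 Prop. 2, p. 36; §12.1, p. 136] -/
theorem HasPureCodim.finrank_le_add_of_isolated_inter {Z₁ Z₂ : Set M} {c₁ c₂ : ℕ}
    (hZ₁ : HasPureCodim 𝓘(ℂ, E) Z₁ c₁) (hZ₂ : HasPureCodim 𝓘(ℂ, E) Z₂ c₂) {a : M}
    (ha : a ∈ Z₁ ∩ Z₂) (hiso : ∃ U ∈ 𝓝 a, U ∩ (Z₁ ∩ Z₂) ⊆ {a}) :
    Module.finrank ℂ E ≤ c₁ + c₂ :=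
  hZ₁.codim_le_of_isRegularPointOfCodim_inter hZ₂ ha
    (isRegularPointOfCodim_finrank_of_isolated ha hiso)

/-- **Analytic sets of excess dimensions do not meet in isolated points**: if `Z₁`, `Z₂` have pure
codimensions `c₁`, `c₂` with `c₁ + c₂ < n`, then no point of `Z₁ ∩ Z₂` is isolated in `Z₁ ∩ Z₂`
(`dim_a (Z₁ ∩ Z₂) ≥ p₁ + p₂ - n > 0` at every `a ∈ Z₁ ∩ Z₂`).
[cite: Chirka1989, §3.5 Prop. 2, p. 36; §12.1, p. 136] -/
theorem HasPureCodim.not_isolated_of_mem_inter {Z₁ Z₂ : Set M} {c₁ c₂ : ℕ}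
    (hZ₁ : HasPureCodim 𝓘(ℂ, E) Z₁ c₁) (hZ₂ : HasPureCodim 𝓘(ℂ, E) Z₂ c₂)
    (hc : c₁ + c₂ < Module.finrank ℂ E) {a : M} (ha : a ∈ Z₁ ∩ Z₂) :
    ¬ ∃ U ∈ 𝓝 a, U ∩ (Z₁ ∩ Z₂) ⊆ {a} := fun hiso =>
  (hc.trans_le (hZ₁.finrank_le_add_of_isolated_inter hZ₂ ha hiso)).false

/-- Equivalent phrasing: every neighbourhood of `a ∈ Z₁ ∩ Z₂` contains another point of
`Z₁ ∩ Z₂`. [cite: Chirka1989, §3.5 Prop. 2, p. 36] -/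
theorem HasPureCodim.exists_mem_inter_ne_of_mem_nhds {Z₁ Z₂ : Set M} {c₁ c₂ : ℕ}
    (hZ₁ : HasPureCodim 𝓘(ℂ, E) Z₁ c₁) (hZ₂ : HasPureCodim 𝓘(ℂ, E) Z₂ c₂)
    (hc : c₁ + c₂ < Module.finrank ℂ E) {a : M} (ha : a ∈ Z₁ ∩ Z₂) {U : Set M} (hU : U ∈ 𝓝 a) :
    ∃ b ∈ U, b ∈ Z₁ ∩ Z₂ ∧ b ≠ a := by
  by_contra h
  push Not at h
  exact hZ₁.not_isolated_of_mem_inter hZ₂ hc ha ⟨U, hU, fun b hb => h b hb.1 hb.2⟩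

/-- `a ∈ Z₁ ∩ Z₂` is an accumulation point of `Z₁ ∩ Z₂` (filter form). [cite: Chirka1989, §3.5
Prop. 2, p. 36] -/
theorem HasPureCodim.frequently_mem_inter_ne {Z₁ Z₂ : Set M} {c₁ c₂ : ℕ}
    (hZ₁ : HasPureCodim 𝓘(ℂ, E) Z₁ c₁) (hZ₂ : HasPureCodim 𝓘(ℂ, E) Z₂ c₂)
    (hc : c₁ + c₂ < Module.finrank ℂ E) {a : M} (ha : a ∈ Z₁ ∩ Z₂) :
    ∃ᶠ b in 𝓝[≠] a, b ∈ Z₁ ∩ Z₂ := by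
  rw [frequently_nhdsWithin_iff, frequently_iff]
  intro U hU
  obtain ⟨b, hbU, hb, hba⟩ := hZ₁.exists_mem_inter_ne_of_mem_nhds hZ₂ hc ha hU
  exact ⟨b, hbU, hb, hba⟩

/-- Dimension form: for `Z₁`, `Z₂` of pure dimensions `p₁`, `p₂` with `p₁ + p₂ > n`, no point of
`Z₁ ∩ Z₂` is isolated in `Z₁ ∩ Z₂`. [cite: Chirka1989, §3.5 Prop. 2, p. 36] -/
theorem HasPureDim.not_isolated_of_mem_inter {Z₁ Z₂ : Set M} {p₁ p₂ : ℕ}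
    (hZ₁ : HasPureDim 𝓘(ℂ, E) Z₁ p₁) (hZ₂ : HasPureDim 𝓘(ℂ, E) Z₂ p₂)
    (hp : Module.finrank ℂ E < p₁ + p₂) {a : M} (ha : a ∈ Z₁ ∩ Z₂) :
    ¬ ∃ U ∈ 𝓝 a, U ∩ (Z₁ ∩ Z₂) ⊆ {a} := by
  obtain ⟨c₁, hc₁, h₁⟩ := hZ₁
  obtain ⟨c₂, hc₂, h₂⟩ := hZ₂
  exact h₁.not_isolated_of_mem_inter h₂ (by omega) ha

/-- In excess dimensions `Z₁ ∩ Z₂` is never zero-dimensional. [cite: Chirka1989, §12.1, p. 136] -/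
theorem HasPureCodim.not_hasPureDim_zero_inter [LocallyCompactSpace M] [T2Space M]
    {Z₁ Z₂ : Set M} {c₁ c₂ : ℕ} (hZ₁ : HasPureCodim 𝓘(ℂ, E) Z₁ c₁)
    (hZ₂ : HasPureCodim 𝓘(ℂ, E) Z₂ c₂) (hc : c₁ + c₂ < Module.finrank ℂ E) :
    ¬ HasPureDim 𝓘(ℂ, E) (Z₁ ∩ Z₂) 0 := by
  intro h0
  have hne : (Z₁ ∩ Z₂).Nonempty := by
    obtain ⟨_, -, h⟩ := h0
    exact h.2.1
  obtain ⟨a, ha⟩ := hne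
  exact hZ₁.not_isolated_of_mem_inter hZ₂ hc ha (h0.exists_nhds_inter_subset_singleton_of_zero ha)

/-! ### Finite families -/

/-- **An isolated point of `⋂_{i ∈ s} Z_i` forces `n ≤ Σ_{i ∈ s} codim Z_i`.**
[cite: Chirka1989, §12.1, p. 136; §3.5 Prop. 2, p. 36] -/
theorem HasPureCodim.finrank_le_sum_of_isolated_biInter {ι : Type*} (s : Finset ι)
    {Z : ι → Set M} {c : ι → ℕ} (hZ : ∀ i ∈ s, HasPureCodim 𝓘(ℂ, E) (Z i) (c i)) {a : M}
    (ha : a ∈ ⋂ i ∈ s, Z i) (hiso : ∃ U ∈ 𝓝 a, U ∩ (⋂ i ∈ s, Z i) ⊆ {a}) :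
    Module.finrank ℂ E ≤ ∑ i ∈ s, c i :=
  HasPureCodim.codim_le_sum_of_isRegularPointOfCodim_biInter s hZ ha
    (isRegularPointOfCodim_finrank_of_isolated ha hiso)

/-- **In excess dimensions `Σ_{i ∈ s} codim Z_i < n`, no point of `⋂_{i ∈ s} Z_i` is isolated.**
[cite: Chirka1989, §12.1, p. 136; §3.5 Prop. 2, p. 36] -/
theorem HasPureCodim.not_isolated_of_mem_biInter {ι : Type*} (s : Finset ι) {Z : ι → Set M}
    {c : ι → ℕ} (hZ : ∀ i ∈ s, HasPureCodim 𝓘(ℂ, E) (Z i) (c i))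
    (hc : ∑ i ∈ s, c i < Module.finrank ℂ E) {a : M} (ha : a ∈ ⋂ i ∈ s, Z i) :
    ¬ ∃ U ∈ 𝓝 a, U ∩ (⋂ i ∈ s, Z i) ⊆ {a} := fun hiso =>
  (hc.trans_le (HasPureCodim.finrank_le_sum_of_isolated_biInter s hZ ha hiso)).false

/-- In excess dimensions `⋂_{i ∈ s} Z_i` is never zero-dimensional ("`⋂ A_j` is zero-dimensional"
requires `Σ codim A_j ≥ n`). [cite: Chirka1989, §12.1, p. 136] -/
theorem HasPureCodim.not_hasPureDim_zero_biInter [LocallyCompactSpace M] [T2Space M]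
    {ι : Type*} (s : Finset ι) {Z : ι → Set M} {c : ι → ℕ}
    (hZ : ∀ i ∈ s, HasPureCodim 𝓘(ℂ, E) (Z i) (c i)) (hc : ∑ i ∈ s, c i < Module.finrank ℂ E) :
    ¬ HasPureDim 𝓘(ℂ, E) (⋂ i ∈ s, Z i) 0 := by
  intro h0
  have hne : (⋂ i ∈ s, Z i).Nonempty := by
    obtain ⟨_, -, h⟩ := h0
    exact h.2.1
  obtain ⟨a, ha⟩ := hne
  exact HasPureCodim.not_isolated_of_mem_biInter s hZ hc ha
    (h0.exists_nhds_inter_subset_singleton_of_zero ha)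

end Literature.Geometry.Kaehler
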